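import Literature.NumberTheory.DiophantineGeometry.AbcDivisorBoundW80ShapeProofs
import Literature.NumberTheory.EllipticCurves.SerreFreyValuationProductProofs
import Literature.NumberTheory.EllipticCurves.SzpiroFreyProofs
import HarnessLib

/-!
# Pasten's `abc` bound `d(abc) ≪_ε rad(abc)^{8/3+ε}` from Theorem 16.4 ALONE among the
# linear-forms-free inputs: the `2`-part through Serre's normalisation and Theorem 16.4 (i)

A *proofs* file (theorems only: no definition, no named fact). H. Pasten, *Shimura curves and the
abc conjecture*, J. Number Theory **254** (2024) = arXiv:1705.09251v4, §16.4 Theorem 16.7 (p. 51;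
the tree's named fact `pasten2024_thm_2_5`). The printed proof bounds the `2`-part `v₂(abc) + 1`
of `d(abc)` by Lemma 15.2 (Stewart–Yu's `2`-adic linear forms estimate) because its Frey curve
`y² = x(x−a)(x+b)` need not be semi-stable at `2`, so that `2` never enters the Shimura factor `D`
of Theorem 16.4. The kernel route of THIS file removes that input:

* if `32 ∤ abc` the `2`-part is at most `5` and the printed argument for the odd primes
  (`prod_factorization_lt_of_thm_16_4_at`, case (ii) of Theorem 16.4) suffices;
* if `32 ∣ abc`, Serre's arrangement `(A, B, A+B)` of `{±a, ±b, ±c}` with `A ≡ −1 (mod 4)`,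
  `32 ∣ B` (`exists_arrangement`, Bombieri–Gubler 12.5.12) gives the Frey curve `E_{A,B}` with
  conductor EXACTLY `rad(abc)` and `v_p(Δ_min) = 2 v_p(abc) − 8·[p = 2]` for all `p`
  (`conductorNorm_freyCurve_serre`, `factorization_minimalDiscriminantNorm_freyCurve_serre` —
  DISCHARGED facts of the tree, Bombieri–Gubler Ex. 12.5.10 / Serre 1987 §4.1); it is semi-stable,
  so **Theorem 16.4 (i)** (`E` semi-stable, `M` not prime) applies with the prime `2` INSIDE the
  `k`-subset averaging over ALL primes of `abc` (`prod_factorization_lt_of_thm_16_4_squarefree`,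
  `M = ∏_{q ∈ T} q` composite for `#T = k ≥ 2`), and `d(abc) ≤ 5 ∏_{p ∣ abc} v_p(Δ_min)`
  (`v₂(abc) + 1 ≤ 5 (2 v₂(abc) − 8)` for `v₂(abc) ≥ 5`).

Result: `card_divisors_lt_of_thm_16_4_serre` — `d(abc) < K rad^{8/3+ε}` from a small-`ω` divisor
bound, Theorem 16.4 (ii) AND Theorem 16.4 (i), with NO `2`-adic input; hence
`pasten2024_thm_2_5_of_pastenShimura2024_thm_16_4_of_prop_15_1` (print's rung from
{Thm 16.4, Prop 15.1} — Lemma 15.2 eliminated), `pasten2024_thm_2_5_of_pastenShimura2024_thm_16_4_of_w80Shape`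
and `…_of_w80Texts` (print's rung from Thm 16.4 and the Waldschmidt-shape binder / the three CLOSED
residue-class texts of summit ABC: for the cell, **`pasten2024_thm_2_5` rests on the typed fact
`pastenShimura2024_thm_16_4` alone**). This is a DEVIATION from the printed proof (which uses only
case (ii) and Lemma 15.2), recorded as such; the statement proved is print's.

## References

* [PastenShimura2024] H. Pasten, J. Number Theory 254 (2024) = arXiv:1705.09251v4 — Thm 16.4
  (p. 50), Thm 16.7 with proof (p. 51).
* [BombieriGubler2006] E. Bombieri, W. Gubler, *Heights in Diophantine Geometry*, CUP 2006 —
  Ex. 12.5.10, Thm 12.5.12.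
* [Serre1987] J.-P. Serre, Duke Math. J. 54 (1987) — §4.1.
-/

noncomputable section

open Finset Real
open Literature.Barriers.ABC
open Literature.NumberTheory.DiophantineGeometry.Pasten

namespace Literature.NumberTheory.DiophantineGeometry

open Literature.NumberTheory.Automorphic (IsAdmissibleFactorization IsFreyHellegouarch)
open Literature.NumberTheory.EllipticCurves (freyCurve pasten_cor_16_2.prod_admissible
  exists_arrangement isElliptic_freyCurve conductorNorm_freyCurve_serre
  factorization_minimalDiscriminantNorm_freyCurve_serre)

/-! ### The `k`-subset averaging over ALL primes of a squarefree level (Theorem 16.4 (i) shape) -/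

/-- **Root trick over all primes of a squarefree `N`.** Let `N` be squarefree with prime set `P`,
`m = #P`, and `v = ν_·(Δ)` positive on `P`. If for every `D > 1`, `D ∣ N` with an even number of
prime factors and `N/D` not prime one has `∏_{p ∣ D} v p < N^e · (N/D)` (the shape of Theorem 16.4
(i)), then for `2 ≤ k < m`, `m − k` even and `m e + k ≤ (m−k) x`: `∏_{p ∈ P} v p < N^x` — take
`D = ∏_{P∖T} q`, `N/D = ∏_T q` (composite) over all `k`-subsets `T` and the `(m−k)`-th root
(`sub_mul_log_prod_lt_of_forall_powersetCard`). [cite: PastenShimura2024, Theorem 16.7 (proof, arXiv:1705.09251v4 p. 51)] -/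
theorem prod_factorization_lt_of_thm_16_4_squarefree {N Δ : ℕ} (hN : Squarefree N) {e x : ℝ}
    {k : ℕ} (hk2 : 2 ≤ k) (hkm : k < N.primeFactors.card)
    (heven : Even (N.primeFactors.card - k))
    (hkey : ((N.primeFactors.card : ℕ) : ℝ) * e + k ≤ (((N.primeFactors.card : ℕ) : ℝ) - k) * x)
    (hv : ∀ q ∈ N.primeFactors, 0 < Δ.factorization q)
    (H : ∀ D : ℕ, 1 < D → D ∣ N → Even D.primeFactors.card → ¬ (N / D).Prime →
      ((∏ p ∈ D.primeFactors, Δ.factorization p : ℕ) : ℝ) < (N : ℝ) ^ e * ((N / D : ℕ) : ℝ)) :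
    ((∏ q ∈ N.primeFactors, Δ.factorization q : ℕ) : ℝ) < (N : ℝ) ^ x := by
  set P : Finset ℕ := N.primeFactors with hPdef
  set v : ℕ → ℕ := fun q => Δ.factorization q with hvdef
  set m : ℕ := P.card with hmdef
  have hN0 : N ≠ 0 := hN.ne_zero
  have hNpos : 0 < N := Nat.pos_of_ne_zero hN0
  have hNpos' : (0 : ℝ) < (N : ℝ) := by exact_mod_cast hNpos
  have hN1 : (1 : ℝ) ≤ (N : ℝ) := by exact_mod_cast hNpos
  have hPprime : ∀ q ∈ P, q.Prime := fun q hq => Nat.prime_of_mem_primeFactors hq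
  have hPprod : ∏ q ∈ P, q = N := Nat.prod_primeFactors_of_squarefree hN
  have hPsub : P ⊆ N.primeFactors.filter (fun p => ¬ p ^ 2 ∣ N) := by
    intro q hq
    rw [mem_filter]
    refine ⟨hq, fun h2 => ?_⟩
    have hq' := hPprime q hq
    exact hq'.one_lt.ne' (Nat.isUnit_iff.mp
      (hN q (by simpa [sq] using h2)))
  have hk1 : 1 ≤ k := by omega
  -- Step 1: the hypothesis of the root lemma, for every `k`-subset `T`.
  have hA : (0 : ℝ) < (N : ℝ) ^ e := by positivity
  have hT : ∀ T ∈ P.powersetCard k,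
      ((∏ p ∈ P \ T, v p : ℕ) : ℝ) < (N : ℝ) ^ e * ((∏ p ∈ T, p : ℕ) : ℝ) := by
    intro T hTm
    have hTP : T ⊆ P := (mem_powersetCard.1 hTm).1
    have hTcard : T.card = k := (mem_powersetCard.1 hTm).2
    have hQ : P \ T ⊆ N.primeFactors.filter (fun p => ¬ p ^ 2 ∣ N) := (sdiff_subset).trans hPsub
    obtain ⟨hDdvd, -, -, hpf⟩ := pasten_cor_16_2.prod_admissible hQ
    set D : ℕ := ∏ q ∈ P \ T, q with hDdef
    have hD0 : 0 < D := prod_pos fun q hq => (hPprime q (sdiff_subset hq)).pos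
    have hcardQ : (P \ T).card = m - k := by rw [card_sdiff_of_subset hTP, hTcard]
    -- `N / D = ∏_T q`
    have hDM : D * ∏ q ∈ T, q = N := by rw [hDdef, prod_sdiff hTP, hPprod]
    have hM : N / D = ∏ q ∈ T, q := by
      rw [← hDM, Nat.mul_div_cancel_left _ hD0]
    have hT0 : 0 < ∏ q ∈ T, q := prod_pos fun q hq => (hPprime q (hTP hq)).pos
    -- `D > 1`: `P \ T` is a nonempty set of primes
    have hQne : (P \ T).Nonempty := by
      rw [← card_pos, hcardQ]; omega
    have hD1 : 1 < D := by
      obtain ⟨q, hq⟩ := hQne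
      have hq2 := (hPprime q (sdiff_subset hq)).two_le
      have : q ≤ D := Nat.le_of_dvd hD0 (dvd_prod_of_mem _ hq)
      omega
    -- `N / D` is not prime: it has the `k ≥ 2` distinct prime factors of `T`
    have hMnp : ¬ (N / D).Prime := by
      intro hp
      have h1 : (N / D).primeFactors = T := by
        rw [hM]; exact Nat.primeFactors_prod fun q hq => hPprime q (hTP hq)
      have h2 : (N / D).primeFactors.card = 1 := by rw [hp.primeFactors, card_singleton]
      rw [h1, hTcard] at h2
      omega
    have hevenD : Even D.primeFactors.card := by rw [hpf, hcardQ]; exact heven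
    have h164 := H D hD1 hDdvd hevenD hMnp
    rw [hpf, hM] at h164
    exact h164
  -- Step 2: the root lemma and the bookkeeping.
  have hroot := sub_mul_log_prod_lt_of_forall_powersetCard hPprime hv hk1 hkm hA hT
  have hVpos : (0 : ℝ) < ((∏ p ∈ P, v p : ℕ) : ℝ) := by exact_mod_cast prod_pos fun p hp => hv p hp
  have hPprod' : ((∏ p ∈ P, p : ℕ) : ℝ) = N := by rw [hPprod]
  have hlogA : Real.log ((N : ℝ) ^ e) = e * Real.log N := Real.log_rpow hNpos' e
  have hlogN : 0 ≤ Real.log (N : ℝ) := Real.log_nonneg hN1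
  have hmk : (0 : ℝ) < (m : ℝ) - k := by
    have : (k : ℝ) < m := by exact_mod_cast hkm
    linarith
  rw [hlogA, hPprod'] at hroot
  have hmain : Real.log ((∏ p ∈ P, v p : ℕ) : ℝ) < x * Real.log N := by
    have h1 : ((m : ℝ) - k) * Real.log ((∏ p ∈ P, v p : ℕ) : ℝ) <
        ((m : ℝ) - k) * (x * Real.log N) := by
      calc ((m : ℝ) - k) * Real.log ((∏ p ∈ P, v p : ℕ) : ℝ)
          < m * (e * Real.log N) + k * Real.log N := hroot
        _ = ((m : ℝ) * e + k) * Real.log N := by ring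
        _ ≤ (((m : ℝ) - k) * x) * Real.log N := mul_le_mul_of_nonneg_right hkey hlogN
        _ = ((m : ℝ) - k) * (x * Real.log N) := by ring
    exact lt_of_mul_lt_mul_left h1 hmk.le
  have hrhs : x * Real.log N = Real.log ((N : ℝ) ^ x) := (Real.log_rpow hNpos' x).symm
  rw [hrhs] at hmain
  exact (Real.log_lt_log_iff hVpos (by positivity)).1 hmain

/-! ### The divisor count against the valuation products -/

/-- `d(n) ≤ (v₂(n) + 1) · ∏_{q ∣ n, q odd} 2 v_q(n)` (`n ≠ 0`). [cite: PastenShimura2024, Theorem 16.7 (proof, arXiv:1705.09251v4 p. 51)] -/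
private theorem card_divisors_le_mul_prod_erase' {n : ℕ} (hn : n ≠ 0) :
    n.divisors.card ≤ (n.factorization 2 + 1) * ∏ q ∈ n.primeFactors.erase 2, 2 * n.factorization q := by
  rw [Nat.card_divisors hn]
  have hodd : ∏ q ∈ n.primeFactors.erase 2, (n.factorization q + 1) ≤
      ∏ q ∈ n.primeFactors.erase 2, 2 * n.factorization q := by
    refine prod_le_prod' fun q hq => ?_
    have h1 : 1 ≤ n.factorization q := by
      rw [Nat.succ_le_iff, pos_iff_ne_zero, ← Finsupp.mem_support_iff, Nat.support_factorization]
      exact mem_of_mem_erase hq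
    omega
  by_cases h2 : 2 ∈ n.primeFactors
  · rw [← mul_prod_erase _ _ h2]
    exact Nat.mul_le_mul_left _ hodd
  · have h0 : n.factorization 2 = 0 := by
      rw [← Finsupp.notMem_support_iff, Nat.support_factorization]; exact h2
    have hP : n.primeFactors.erase 2 = n.primeFactors := erase_eq_of_notMem h2
    rw [h0, zero_add, one_mul]
    calc ∏ x ∈ n.primeFactors, (n.factorization x + 1)
        = ∏ q ∈ n.primeFactors.erase 2, (n.factorization q + 1) := by rw [hP]
      _ ≤ _ := hodd

/-- For `32 ∣ n`: `d(n) ≤ 5 · ∏_{q ∣ n} (2 v_q(n) − 8·[q = 2])` — at odd `q`, `v + 1 ≤ 2v`; at `2`,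
`v₂ + 1 ≤ 5 (2 v₂ − 8)` since `v₂ ≥ 5`. [cite: PastenShimura2024, Theorem 16.7 (proof, arXiv:1705.09251v4 p. 51)] -/
private theorem card_divisors_le_five_mul_prod_serre {n : ℕ} (hn : n ≠ 0) (h32 : 32 ∣ n) :
    n.divisors.card ≤ 5 * ∏ q ∈ n.primeFactors,
      (2 * n.factorization q - if q = 2 then 8 else 0) := by
  have h2 : 2 ∈ n.primeFactors :=
    Nat.mem_primeFactors.2 ⟨Nat.prime_two, (dvd_trans (by norm_num) h32), hn⟩
  have hv2 : 5 ≤ n.factorization 2 := by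
    have : 2 ^ 5 ∣ n := by simpa using h32
    exact (Nat.Prime.pow_dvd_iff_le_factorization Nat.prime_two hn).1 this
  rw [Nat.card_divisors hn, ← mul_prod_erase _ _ h2, ← mul_prod_erase _ (fun q => 2 * n.factorization q - if q = 2 then 8 else 0) h2]
  simp only [if_true]
  have hodd : ∏ q ∈ n.primeFactors.erase 2, (n.factorization q + 1) ≤
      ∏ q ∈ n.primeFactors.erase 2, (2 * n.factorization q - if q = 2 then 8 else 0) := by
    refine prod_le_prod' fun q hq => ?_
    have hq2 : q ≠ 2 := (mem_erase.1 hq).1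
    rw [if_neg hq2]
    have h1 : 1 ≤ n.factorization q := by
      rw [Nat.succ_le_iff, pos_iff_ne_zero, ← Finsupp.mem_support_iff, Nat.support_factorization]
      exact mem_of_mem_erase hq
    omega
  calc (n.factorization 2 + 1) * ∏ q ∈ n.primeFactors.erase 2, (n.factorization q + 1)
      ≤ (5 * (2 * n.factorization 2 - 8)) *
          ∏ q ∈ n.primeFactors.erase 2, (2 * n.factorization q - if q = 2 then 8 else 0) :=
        Nat.mul_le_mul (by omega) hodd
    _ = _ := by ring

/-! ### The core with the `2`-part through Serre's normalisation -/

/-- The exponent bookkeeping of the printed proof: with `ε' = ε/4`, `k ∈ {2, 3}` and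
`m ≥ 44/ε + 7`, `m(8/3+ε') + k ≤ (m−k)(8/3+ε/2)` and `m ≤ 3(m−k)`.
[cite: PastenShimura2024, Theorem 16.7 (proof, arXiv:1705.09251v4 p. 51)] -/
private theorem exponent_bookkeeping' {ε : ℝ} (hε : 0 < ε) {m k : ℕ} (hk : k = 2 ∨ k = 3)
    (hm : 44 / ε + 7 ≤ (m : ℝ)) :
    (m : ℝ) * (8 / 3 + ε / 4) + k ≤ ((m : ℝ) - k) * (8 / 3 + ε / 2) ∧
      (m : ℝ) ≤ 3 * ((m : ℝ) - k) ∧ k < m := by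
  have hmε : 44 + 7 * ε ≤ (m : ℝ) * ε := by
    have := mul_le_mul_of_nonneg_right hm hε.le
    rwa [add_mul, div_mul_cancel₀ _ hε.ne'] at this
  have h7 : (7 : ℝ) ≤ m := le_trans (by linarith [show (0:ℝ) < 44 / ε by positivity]) hm
  have h7' : 7 ≤ m := by exact_mod_cast h7
  rcases hk with rfl | rfl
  · refine ⟨?_, ?_, by omega⟩
    · push_cast; nlinarith
    · push_cast; linarith
  · refine ⟨?_, ?_, by omega⟩
    · push_cast; nlinarith
    · push_cast; linarith

/-- `32 ∣ B` for Serre's arrangement: `|AB(A+B)| = abc` with `32 ∣ abc`, `A` odd, `B` even. [folklore] -/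
private theorem thirtytwo_dvd_of_arrangement {A B : ℤ} {n : ℕ} (hA4 : 4 ∣ A + 1)
    (hB16 : (16 : ℤ) ∣ B) (hprod : (A * B * (A + B)).natAbs = n) (h32 : 32 ∣ n) :
    (32 : ℤ) ∣ B := by
  have hAodd : Odd A := by
    obtain ⟨t, ht⟩ := hA4
    exact ⟨2 * t - 1, by omega⟩
  have hBeven : Even B := by
    obtain ⟨s, hs⟩ := hB16
    exact ⟨8 * s, by omega⟩
  have hodd : Odd (A * (A + B)) := hAodd.mul (hAodd.add_even hBeven)
  have hcop : IsCoprime (32 : ℤ) (A * (A + B)) := by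
    rw [Int.isCoprime_iff_gcd_eq_one]
    have h1 : Nat.Coprime 32 (A * (A + B)).natAbs := by
      rw [show (32 : ℕ) = 2 ^ 5 by norm_num]
      exact Nat.Coprime.pow_left 5 (Nat.coprime_two_left.mpr (Int.natAbs_odd.mpr hodd))
    rw [Int.gcd_eq_natAbs]
    simpa using h1
  have h32Z : (32 : ℤ) ∣ A * B * (A + B) := by
    have h1 : 32 ∣ (A * B * (A + B)).natAbs := by rw [hprod]; exact h32
    have h2 := Int.natCast_dvd.mpr h1
    simpa using h2
  have h32' : (32 : ℤ) ∣ B * (A * (A + B)) := by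
    rw [show B * (A * (A + B)) = A * B * (A + B) by ring]; exact h32Z
  exact hcop.dvd_of_dvd_mul_right h32'

section Core

variable {a b c : ℕ}

/-- **`d(abc) < K_ε rad(abc)^{8/3+ε}` from a small-`ω` divisor bound and Theorem 16.4, cases (ii)
AND (i), with no `2`-adic input** (module docstring): `ν = max(max(N₁,N₂)+1, ⌈44/ε⌉ + 8)`; triples
with `ω(abc) ≤ ν + 1` by the first hypothesis; otherwise, if `32 ∤ abc`, the printed case-(ii)
argument on the odd primes (`prod_factorization_lt_of_thm_16_4_at`) with `v₂(abc) + 1 ≤ 5`; if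
`32 ∣ abc`, Serre's arrangement (`exists_arrangement`) and case (i) over all primes
(`prod_factorization_lt_of_thm_16_4_squarefree`; `N = rad(abc)`, `v_p(Δ) = 2v_p(abc) − 8[p=2]`),
`d(abc) ≤ 5 ∏ v_p(Δ) < 5 rad^{8/3+ε/2}`. [cite: PastenShimura2024, Theorem 16.7 with its proof (§16.4, arXiv:1705.09251v4 p. 51)]
[cite: BombieriGubler2006, Ex. 12.5.10 and Thm. 12.5.12] -/
theorem card_divisors_lt_of_thm_16_4_serre {ε : ℝ} (hε : 0 < ε)
    (hsmall : ∀ ν : ℕ, ∃ K : ℝ, 0 < K ∧ ∀ a b c : ℕ, IsABCTriple a b c →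
      (a * b * c).primeFactors.card = ν →
        ((a * b * c).divisors.card : ℝ) ≤ K * (rad a b c : ℝ) ^ (8 / 3 + ε))
    (h164ii : ∃ N₀ : ℕ, ∀ (W : WeierstrassCurve ℚ) [W.IsElliptic],
      IsFreyHellegouarch W → N₀ ≤ W.conductorNorm ℤ →
        ∀ D M : ℕ, IsAdmissibleFactorization (W.conductorNorm ℤ) D M →
          2 ≤ (M.primeFactors.erase 2).card →
            ((∏ p ∈ D.primeFactors, (W.minimalDiscriminantNorm ℤ).factorization p : ℕ) : ℝ)
              < (W.conductorNorm ℤ : ℝ) ^ ((8 : ℝ) / 3 + ε / 4) * (M : ℝ))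
    (h164i : ∃ N₀ : ℕ, ∀ (W : WeierstrassCurve ℚ) [W.IsElliptic],
      Squarefree (W.conductorNorm ℤ) → N₀ ≤ W.conductorNorm ℤ →
        ∀ D : ℕ, 1 < D → D ∣ W.conductorNorm ℤ → Even D.primeFactors.card →
          ¬ (W.conductorNorm ℤ / D).Prime →
            ((∏ p ∈ D.primeFactors, (W.minimalDiscriminantNorm ℤ).factorization p : ℕ) : ℝ)
              < (W.conductorNorm ℤ : ℝ) ^ (8 / 3 + ε / 4 : ℝ) * ((W.conductorNorm ℤ / D : ℕ) : ℝ)) :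
    ∃ K : ℝ, 0 < K ∧ ∀ a b c : ℕ, IsABCTriple a b c →
      ((a * b * c).divisors.card : ℝ) < K * (rad a b c : ℝ) ^ (8 / 3 + ε) := by
  classical
  -- constants chosen before the triple
  obtain ⟨N₁, hN₁⟩ := h164ii
  obtain ⟨N₂, hN₂⟩ := h164i
  obtain ⟨ν, hνdef⟩ : ∃ ν : ℕ, ν = max (max N₁ N₂ + 1) (⌈44 / ε⌉₊ + 8) := ⟨_, rfl⟩
  have hνN : max N₁ N₂ + 1 ≤ ν := by rw [hνdef]; exact le_max_left _ _
  have hν44 : ⌈44 / ε⌉₊ + 8 ≤ ν := by rw [hνdef]; exact le_max_right _ _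
  have hN₁ν : N₁ + 1 ≤ ν := le_trans (by have := le_max_left N₁ N₂; omega) hνN
  have hN₂ν : N₂ + 1 ≤ ν := le_trans (by have := le_max_right N₁ N₂; omega) hνN
  choose Kf hKf0 hKf using hsmall
  obtain ⟨Ks, hKsdef⟩ : ∃ Ks : ℝ, Ks = ∑ j ∈ Finset.range (ν + 2), Kf j := ⟨_, rfl⟩
  have hKs0 : 0 ≤ Ks := by rw [hKsdef]; exact sum_nonneg fun j _ => (hKf0 j).le
  obtain ⟨Cl, hCldef⟩ : ∃ Cl : ℝ, Cl = 5 * (2 ^ 27 * (2 ^ 8 : ℝ) ^ (8 / 3 + ε / 2 : ℝ)) := ⟨_, rfl⟩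
  have hCl5 : 5 ≤ Cl := by
    have h1 : (1 : ℝ) ≤ 2 ^ 27 := by norm_num
    have h2 : (1 : ℝ) ≤ (2 ^ 8 : ℝ) ^ (8 / 3 + ε / 2 : ℝ) := Real.one_le_rpow (by norm_num) (by positivity)
    have := one_le_mul_of_one_le_of_one_le h1 h2
    rw [hCldef]; nlinarith
  have hCl0 : 0 < Cl := by linarith
  refine ⟨Ks + Cl + 1, by linarith, fun a b c h => ?_⟩
  have h0 := h.mul_ne_zero
  obtain ⟨ha, hb, habc, hcop⟩ := id h
  have hc0 : c ≠ 0 := by omega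
  have hR1 : (1 : ℝ) ≤ (rad a b c : ℝ) := one_le_rad_real a b c
  have hR0 : (0 : ℝ) < (rad a b c : ℝ) := by positivity
  have hRpow : (0 : ℝ) < (rad a b c : ℝ) ^ (8 / 3 + ε : ℝ) := by positivity
  have hRexp : (rad a b c : ℝ) ^ (8 / 3 + ε / 2 : ℝ) ≤ (rad a b c : ℝ) ^ (8 / 3 + ε : ℝ) :=
    Real.rpow_le_rpow_of_exponent_le hR1 (by linarith)
  have hslack : (0 : ℝ) < (Ks + 1) * (rad a b c : ℝ) ^ (8 / 3 + ε : ℝ) :=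
    mul_pos (by linarith) hRpow
  have h44R : ∀ m : ℕ, ν ≤ m + 1 → 44 / ε + 7 ≤ ((m : ℕ) : ℝ) := by
    intro m hm
    have h1 : (44 / ε : ℝ) ≤ ⌈44 / ε⌉₊ := Nat.le_ceil _
    have h2 : ((⌈44 / ε⌉₊ + 8 : ℕ) : ℝ) ≤ (m : ℝ) + 1 := by exact_mod_cast hν44.trans hm
    push_cast at h2
    linarith
  -- the radical as the product of the primes
  have hradprod : ∏ q ∈ (a * b * c).primeFactors, q = rad a b c := by
    rw [rad_def, Nat.radical_eq_prod_primeFactors]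
  have h2pow : 2 ^ (a * b * c).primeFactors.card ≤ ∏ q ∈ (a * b * c).primeFactors, q :=
    pow_card_le_prod _ (fun q => q) 2 fun q hq => (Nat.prime_of_mem_primeFactors hq).two_le
  have hωlt := (a * b * c).primeFactors.card.lt_two_pow_self
  by_cases hω : (a * b * c).primeFactors.card < ν + 2
  · -- few prime factors
    have hd := hKf _ a b c h rfl
    have hKj : Kf (a * b * c).primeFactors.card ≤ Ks := by
      rw [hKsdef]
      exact single_le_sum (f := Kf) (fun i _ => (hKf0 i).le) (mem_range.2 hω)
    calc ((a * b * c).divisors.card : ℝ)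
        ≤ Kf (a * b * c).primeFactors.card * (rad a b c : ℝ) ^ (8 / 3 + ε) := hd
      _ ≤ Ks * (rad a b c : ℝ) ^ (8 / 3 + ε : ℝ) := mul_le_mul_of_nonneg_right hKj hRpow.le
      _ < (Ks + Cl + 1) * (rad a b c : ℝ) ^ (8 / 3 + ε : ℝ) := by
          have := mul_pos hCl0 hRpow
          linarith
  rw [not_lt] at hω
  by_cases h32 : 32 ∣ a * b * c
  · -- **`32 ∣ abc`: Serre's normalisation and Theorem 16.4 (i) over ALL primes of `abc`**
    obtain ⟨A, B, hAB, hA4, hB16, hprod, -⟩ := exists_arrangement h (dvd_trans (by norm_num) h32)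
    have hABC0 : A * B * (A + B) ≠ 0 := by
      intro hz
      rw [hz, Int.natAbs_zero] at hprod
      exact h0 hprod.symm
    have hA : A ≡ -1 [ZMOD 4] := by
      obtain ⟨t, ht⟩ := hA4
      exact (Int.modEq_iff_dvd.mpr ⟨-t, by linarith⟩)
    have hB32 : (32 : ℤ) ∣ B := thirtytwo_dvd_of_arrangement hA4 hB16 hprod h32
    haveI : (freyCurve A B).IsElliptic := isElliptic_freyCurve hABC0
    have hNW : (freyCurve A B).conductorNorm ℤ = rad a b c := by
      rw [conductorNorm_freyCurve_serre hAB hABC0 hA hB32, hprod, ← rad_def]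
    have hsqN : Squarefree ((freyCurve A B).conductorNorm ℤ) := by
      rw [hNW, rad_def]; exact UniqueFactorizationMonoid.squarefree_radical
    have hPW : ((freyCurve A B).conductorNorm ℤ).primeFactors = (a * b * c).primeFactors := by
      rw [hNW, rad_def, Nat.primeFactors_radical]
    have hN₂W : N₂ ≤ (freyCurve A B).conductorNorm ℤ := by
      rw [hNW, ← hradprod]
      omega
    -- valuations of `Δ_min`
    have hvW : ∀ q : ℕ, ((freyCurve A B).minimalDiscriminantNorm ℤ).factorization q =
        2 * (a * b * c).factorization q - if q = 2 then 8 else 0 := by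
      intro q
      rw [factorization_minimalDiscriminantNorm_freyCurve_serre hAB hABC0 hA hB32 q, hprod]
    have hv2 : 5 ≤ (a * b * c).factorization 2 :=
      (Nat.Prime.pow_dvd_iff_le_factorization Nat.prime_two h0).1 (by simpa using h32)
    have hvpos : ∀ q ∈ ((freyCurve A B).conductorNorm ℤ).primeFactors,
        0 < ((freyCurve A B).minimalDiscriminantNorm ℤ).factorization q := by
      intro q hq
      rw [hPW] at hq
      have h1 : 1 ≤ (a * b * c).factorization q := by
        rw [Nat.succ_le_iff, pos_iff_ne_zero, ← Finsupp.mem_support_iff, Nat.support_factorization]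
        exact hq
      rw [hvW q]
      split_ifs with hq2
      · subst hq2; omega
      · omega
    -- parity and bookkeeping, `m = ω(abc)`
    have hmR : 44 / ε + 7 ≤ (((a * b * c).primeFactors.card : ℕ) : ℝ) := h44R _ (by omega)
    obtain ⟨k, hk, hkeven⟩ : ∃ k : ℕ, (k = 2 ∨ k = 3) ∧
        Even ((a * b * c).primeFactors.card - k) := by
      rcases Nat.even_or_odd (a * b * c).primeFactors.card with ⟨t, ht⟩ | ⟨t, ht⟩
      · exact ⟨2, Or.inl rfl, ⟨t - 1, by omega⟩⟩
      · exact ⟨3, Or.inr rfl, ⟨t - 1, by omega⟩⟩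
    obtain ⟨hkey, -, hkm⟩ := exponent_bookkeeping' hε hk hmR
    have hk2 : 2 ≤ k := by rcases hk with rfl | rfl <;> norm_num
    have H : ∀ D : ℕ, 1 < D → D ∣ (freyCurve A B).conductorNorm ℤ → Even D.primeFactors.card →
        ¬ ((freyCurve A B).conductorNorm ℤ / D).Prime →
          ((∏ p ∈ D.primeFactors, ((freyCurve A B).minimalDiscriminantNorm ℤ).factorization p : ℕ) : ℝ)
            < ((freyCurve A B).conductorNorm ℤ : ℝ) ^ (8 / 3 + ε / 4 : ℝ) *
              (((freyCurve A B).conductorNorm ℤ / D : ℕ) : ℝ) :=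
      fun D h1 h2 h3 h4 => hN₂ _ hsqN hN₂W D h1 h2 h3 h4
    have hcore := prod_factorization_lt_of_thm_16_4_squarefree hsqN (e := 8 / 3 + ε / 4)
      (x := 8 / 3 + ε / 2) hk2 (by rw [hPW]; exact hkm) (by rw [hPW]; exact hkeven)
      (by rw [hPW]; exact hkey) hvpos H
    rw [hPW, hNW] at hcore
    -- `d(abc) ≤ 5 ∏ v_q(Δ_min)`
    have hd := card_divisors_le_five_mul_prod_serre h0 h32
    have hprodv : ∏ q ∈ (a * b * c).primeFactors, (2 * (a * b * c).factorization q - if q = 2 then 8 else 0)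
        = ∏ q ∈ (a * b * c).primeFactors, ((freyCurve A B).minimalDiscriminantNorm ℤ).factorization q :=
      prod_congr rfl fun q _ => (hvW q).symm
    rw [hprodv] at hd
    have hd' : ((a * b * c).divisors.card : ℝ) ≤
        5 * ((∏ q ∈ (a * b * c).primeFactors,
          ((freyCurve A B).minimalDiscriminantNorm ℤ).factorization q : ℕ) : ℝ) := by
      exact_mod_cast hd
    calc ((a * b * c).divisors.card : ℝ) ≤ _ := hd'
      _ < 5 * (rad a b c : ℝ) ^ (8 / 3 + ε / 2 : ℝ) := mul_lt_mul_of_pos_left hcore (by norm_num)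
      _ ≤ Cl * (rad a b c : ℝ) ^ (8 / 3 + ε : ℝ) := mul_le_mul hCl5 hRexp (by positivity) hCl0.le
      _ < (Ks + Cl + 1) * (rad a b c : ℝ) ^ (8 / 3 + ε : ℝ) := by linarith
  · -- **`32 ∤ abc`: `v₂(abc) ≤ 4`, and the printed case-(ii) argument on the odd primes**
    have hv2le : (a * b * c).factorization 2 ≤ 4 := by
      have h5 : ¬ 5 ≤ (a * b * c).factorization 2 := fun h5 =>
        h32 (by simpa using (Nat.Prime.pow_dvd_iff_le_factorization Nat.prime_two h0).2 h5)
      omega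
    haveI := h.freyCurve_isElliptic
    have hNpos : 0 < (freyCurve (a : ℤ) (b : ℤ)).conductorNorm ℤ :=
      (freyCurve (a : ℤ) (b : ℤ)).conductorNorm_pos_holds
    have hPprime : ∀ q ∈ (a * b * c).primeFactors.erase 2, q.Prime := fun q hq =>
      Nat.prime_of_mem_primeFactors (mem_of_mem_erase hq)
    have hmodd : ν + 1 ≤ ((a * b * c).primeFactors.erase 2).card := by
      have := pred_card_le_card_erase (s := (a * b * c).primeFactors) (a := 2)
      omega
    -- `N ≥ N₁`: `N ≥ ∏_{odd} q ≥ 2^{m} > m ≥ ν + 1 > N₁`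
    obtain ⟨hPdvd, -, -, -⟩ := pasten_cor_16_2.prod_admissible h.erase_two_subset_filter
    have hN₁N : N₁ ≤ (freyCurve (a : ℤ) (b : ℤ)).conductorNorm ℤ := by
      have h1 : 2 ^ ((a * b * c).primeFactors.erase 2).card ≤ ∏ q ∈ (a * b * c).primeFactors.erase 2, q :=
        pow_card_le_prod _ (fun q => q) 2 fun q hq => (hPprime q hq).two_le
      have h2 := ((a * b * c).primeFactors.erase 2).card.lt_two_pow_self
      have h3 := Nat.le_of_dvd hNpos hPdvd
      omega
    have hmR : 44 / ε + 7 ≤ ((((a * b * c).primeFactors.erase 2).card : ℕ) : ℝ) := h44R _ (by omega)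
    obtain ⟨k, hk, hkeven⟩ : ∃ k : ℕ, (k = 2 ∨ k = 3) ∧
        Even (((a * b * c).primeFactors.erase 2).card - k) := by
      rcases Nat.even_or_odd ((a * b * c).primeFactors.erase 2).card with ⟨t, ht⟩ | ⟨t, ht⟩
      · exact ⟨2, Or.inl rfl, ⟨t - 1, by omega⟩⟩
      · exact ⟨3, Or.inr rfl, ⟨t - 1, by omega⟩⟩
    obtain ⟨hkey, hkey2, hkm⟩ := exponent_bookkeeping' hε hk hmR
    have hk2 : 2 ≤ k := by rcases hk with rfl | rfl <;> norm_num
    have H : ∀ D M : ℕ, IsAdmissibleFactorization ((freyCurve (a : ℤ) (b : ℤ)).conductorNorm ℤ) D M →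
        2 ≤ (M.primeFactors.erase 2).card →
          ((∏ p ∈ D.primeFactors,
              ((freyCurve (a : ℤ) (b : ℤ)).minimalDiscriminantNorm ℤ).factorization p : ℕ) : ℝ) <
            (((freyCurve (a : ℤ) (b : ℤ)).conductorNorm ℤ : ℕ) : ℝ) ^ (8 / 3 + ε / 4 : ℝ) * (M : ℝ) :=
      fun D M hadm hM => hN₁ _ h.freyCurve_isFreyHellegouarch hN₁N D M hadm hM
    have hcore := prod_factorization_lt_of_thm_16_4_at h hk2 hkm hkeven hkey hkey2 H
    have hprodv : ∏ q ∈ (a * b * c).primeFactors.erase 2, 2 * (a * b * c).factorization q =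
        ∏ q ∈ (a * b * c).primeFactors.erase 2,
          ((freyCurve (a : ℤ) (b : ℤ)).minimalDiscriminantNorm ℤ).factorization q :=
      prod_congr rfl fun q hq => by
        have h' := hq
        rw [mem_erase, Nat.mem_primeFactors] at h'
        rw [h.factorization_minimalDiscriminantNorm_freyCurve h'.2.1 h'.1]
    have hdnat := card_divisors_le_mul_prod_erase' h0
    rw [hprodv] at hdnat
    have hd : ((a * b * c).divisors.card : ℝ) ≤
        (((a * b * c).factorization 2 + 1 : ℕ) : ℝ) *
          ((∏ q ∈ (a * b * c).primeFactors.erase 2,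
            ((freyCurve (a : ℤ) (b : ℤ)).minimalDiscriminantNorm ℤ).factorization q : ℕ) : ℝ) := by
      exact_mod_cast hdnat
    have hv2 : (((a * b * c).factorization 2 + 1 : ℕ) : ℝ) ≤ 5 := by
      have : (a * b * c).factorization 2 + 1 ≤ 5 := by omega
      exact_mod_cast this
    have hNpow : (((freyCurve (a : ℤ) (b : ℤ)).conductorNorm ℤ : ℕ) : ℝ) ^ (8 / 3 + ε / 2 : ℝ) ≤
        (2 ^ 8 : ℝ) ^ (8 / 3 + ε / 2 : ℝ) * (rad a b c : ℝ) ^ (8 / 3 + ε / 2 : ℝ) := by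
      rw [← Real.mul_rpow (by positivity) hR0.le]
      exact Real.rpow_le_rpow (by positivity) h.conductorNorm_freyCurve_le (by positivity)
    have hprod0 : (0 : ℝ) ≤ ((∏ q ∈ (a * b * c).primeFactors.erase 2,
        ((freyCurve (a : ℤ) (b : ℤ)).minimalDiscriminantNorm ℤ).factorization q : ℕ) : ℝ) := by
      positivity
    calc ((a * b * c).divisors.card : ℝ) ≤ _ := hd
      _ ≤ 5 * (2 ^ 27 * (((freyCurve (a : ℤ) (b : ℤ)).conductorNorm ℤ : ℕ) : ℝ) ^ (8 / 3 + ε / 2 : ℝ)) :=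
          mul_le_mul hv2 hcore.le hprod0 (by norm_num)
      _ ≤ 5 * (2 ^ 27 * ((2 ^ 8 : ℝ) ^ (8 / 3 + ε / 2 : ℝ) * (rad a b c : ℝ) ^ (8 / 3 + ε / 2 : ℝ))) :=
          mul_le_mul_of_nonneg_left (mul_le_mul_of_nonneg_left hNpow (by positivity)) (by norm_num)
      _ = Cl * (rad a b c : ℝ) ^ (8 / 3 + ε / 2 : ℝ) := by rw [hCldef]; ring
      _ ≤ Cl * (rad a b c : ℝ) ^ (8 / 3 + ε : ℝ) := mul_le_mul_of_nonneg_left hRexp hCl0.le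
      _ < (Ks + Cl + 1) * (rad a b c : ℝ) ^ (8 / 3 + ε : ℝ) := by linarith

end Core

/-! ### The rung from Theorem 16.4 with the `2`-adic input removed -/

/-- **Print's rung from {Theorem 16.4, Proposition 15.1} — Lemma 15.2 eliminated**: the typed
Theorem 16.4 (both cases) and the typed Proposition 15.1 (small `ω`, through its "in particular"
clause) give `pasten2024_thm_2_5`. [cite: PastenShimura2024, Theorem 16.7 with its proof (§16.4, arXiv:1705.09251v4 p. 51)] -/
theorem pasten2024_thm_2_5_of_pastenShimura2024_thm_16_4_of_prop_15_1
    (h151 : pastenShimura2024_prop_15_1) (h164 : pastenShimura2024_thm_16_4) :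
    pasten2024_thm_2_5 := by
  refine pasten2024_thm_2_5_of_card_divisors_lt fun ε hε => ?_
  have hsmall : ∀ ν : ℕ, ∃ K : ℝ, 0 < K ∧ ∀ a b c : ℕ, IsABCTriple a b c →
      (a * b * c).primeFactors.card = ν →
        ((a * b * c).divisors.card : ℝ) ≤ K * (rad a b c : ℝ) ^ (8 / 3 + ε) := by
    intro ν
    obtain ⟨K, hK0, hK⟩ := h151.card_divisors_le_of_card_primeFactors_eq ε hε ν
    refine ⟨K, hK0, fun a b c h hν => (hK a b c h hν).trans ?_⟩
    exact mul_le_mul_of_nonneg_left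
      (Real.rpow_le_rpow_of_exponent_le (one_le_rad_real a b c) (by linarith)) hK0.le
  exact card_divisors_lt_of_thm_16_4_serre hε hsmall (h164.freyHellegouarch (ε / 4) (by positivity))
    (h164.squarefree (ε / 4) (by positivity))

section W80

variable (c₅ : ℝ)

/-- **Print's rung from Theorem 16.4 and the Waldschmidt-shape binder** (`hW` of
`Literature.Barriers.ABC.stewartYu1991_of_w80Shape`; small `ω` via `card_divisors_le_of_w80Shape`,
`rad^{2+ε} ≤ rad^{8/3+ε}`): no `2`-adic estimate of Yu-2007 quality is needed any more.
[cite: PastenShimura2024, Theorem 16.7 with its proof (§16.4, arXiv:1705.09251v4 p. 51)]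
[cite: StewartYu1991, §3] -/
theorem pasten2024_thm_2_5_of_pastenShimura2024_thm_16_4_of_w80Shape
    (hW : ∀ (p : ℕ), p.Prime → ∀ (S : Finset ℕ), (∀ q ∈ S, q.Prime) → p ∉ S → S.Nonempty →
      ∀ (e : ℕ → ℤ) (B : ℝ), 3 ≤ B → (∀ q ∈ S, (|e q| : ℝ) ≤ B) →
      ∏ q ∈ S, (q : ℚ) ^ e q ≠ 1 →
      (padicValRat p (∏ q ∈ S, (q : ℚ) ^ e q - 1) : ℝ) <
        (c₅ * S.card) ^ S.card * (p : ℝ) ^ 2 *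
          ((Real.log B + Real.log (Real.log ((max 4 (S.sup id) : ℕ) : ℝ))) *
            Real.log (Real.log ((max 4 (S.sup id) : ℕ) : ℝ))) *
          ∏ q ∈ S, Real.log ((max 4 q : ℕ) : ℝ))
    (h164 : pastenShimura2024_thm_16_4) : pasten2024_thm_2_5 := by
  refine pasten2024_thm_2_5_of_card_divisors_lt fun ε hε => ?_
  have hsmall : ∀ ν : ℕ, ∃ K : ℝ, 0 < K ∧ ∀ a b c : ℕ, IsABCTriple a b c →
      (a * b * c).primeFactors.card = ν →
        ((a * b * c).divisors.card : ℝ) ≤ K * (rad a b c : ℝ) ^ (8 / 3 + ε) := by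
    intro ν
    obtain ⟨K, hK0, hKν⟩ := card_divisors_le_of_w80Shape c₅ hW ε hε ν
    refine ⟨K, hK0, fun a b c h hν => (hKν a b c h hν).trans ?_⟩
    exact mul_le_mul_of_nonneg_left
      (Real.rpow_le_rpow_of_exponent_le (one_le_rad_real a b c) (by linarith)) hK0.le
  exact card_divisors_lt_of_thm_16_4_serre hε hsmall (h164.freyHellegouarch (ε / 4) (by positivity))
    (h164.squarefree (ε / 4) (by positivity))

end W80

/-- **Print's rung from the typed Theorem 16.4 and the three residue-class texts of summit ABC**
(`W80ThreeModFour`, `W80OneModFour`, `W80Two` of route `PadicPrimesW80TwoThirds`, all CLOSED): for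
the cell, `pasten2024_thm_2_5` — Pasten's `d(abc) ≪_ε rad(abc)^{8/3+ε}` — rests on the typed fact
`pastenShimura2024_thm_16_4` ALONE. [cite: PastenShimura2024, Theorem 16.4 (p. 50) and Theorem 16.7 (proof, p. 51), arXiv:1705.09251v4] -/
theorem pasten2024_thm_2_5_of_pastenShimura2024_thm_16_4_of_w80Texts
    (h₃ : ∃ c₅ : ℝ, ∀ (p : ℕ), p.Prime → p % 4 = 3 → ∀ (S : Finset ℕ), (∀ q ∈ S, q.Prime) → p ∉ S →
      S.Nonempty → ∀ (e : ℕ → ℤ) (B : ℝ), 3 ≤ B → (∀ q ∈ S, (|e q| : ℝ) ≤ B) →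
      ∏ q ∈ S, (q : ℚ) ^ e q ≠ 1 →
      (padicValRat p (∏ q ∈ S, (q : ℚ) ^ e q - 1) : ℝ) <
        (c₅ * S.card) ^ S.card * (p : ℝ) ^ 2 *
          ((Real.log B + Real.log (Real.log ((max 4 (S.sup id) : ℕ) : ℝ))) *
            Real.log (Real.log ((max 4 (S.sup id) : ℕ) : ℝ))) *
          ∏ q ∈ S, Real.log ((max 4 q : ℕ) : ℝ))
    (h₁ : ∃ c₅ : ℝ, ∀ (p : ℕ), p.Prime → p % 4 = 1 → ∀ (S : Finset ℕ), (∀ q ∈ S, q.Prime) → p ∉ S →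
      S.Nonempty → ∀ (e : ℕ → ℤ) (B : ℝ), 3 ≤ B → (∀ q ∈ S, (|e q| : ℝ) ≤ B) →
      ∏ q ∈ S, (q : ℚ) ^ e q ≠ 1 →
      (padicValRat p (∏ q ∈ S, (q : ℚ) ^ e q - 1) : ℝ) <
        (c₅ * S.card) ^ S.card * (p : ℝ) ^ 2 *
          ((Real.log B + Real.log (Real.log ((max 4 (S.sup id) : ℕ) : ℝ))) *
            Real.log (Real.log ((max 4 (S.sup id) : ℕ) : ℝ))) *
          ∏ q ∈ S, Real.log ((max 4 q : ℕ) : ℝ))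
    (h₂ : ∃ c₅ : ℝ, ∀ (S : Finset ℕ), (∀ q ∈ S, q.Prime) → 2 ∉ S → S.Nonempty →
      ∀ (e : ℕ → ℤ) (B : ℝ), 3 ≤ B → (∀ q ∈ S, (|e q| : ℝ) ≤ B) → ∏ q ∈ S, (q : ℚ) ^ e q ≠ 1 →
      (padicValRat 2 (∏ q ∈ S, (q : ℚ) ^ e q - 1) : ℝ) <
        (c₅ * S.card) ^ S.card * (2 : ℝ) ^ 2 *
          ((Real.log B + Real.log (Real.log ((max 4 (S.sup id) : ℕ) : ℝ))) *
            Real.log (Real.log ((max 4 (S.sup id) : ℕ) : ℝ))) *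
          ∏ q ∈ S, Real.log ((max 4 q : ℕ) : ℝ))
    (h164 : pastenShimura2024_thm_16_4) : pasten2024_thm_2_5 := by
  obtain ⟨c₅, hW⟩ := exists_w80Shape_of_residueClassTexts h₃ h₁ h₂
  exact pasten2024_thm_2_5_of_pastenShimura2024_thm_16_4_of_w80Shape c₅ hW h164

end Literature.NumberTheory.DiophantineGeometry

end
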